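import Summits.ResolutionOfSingularities.ResolutionOfSingularities.Theorems.HilbertSamuelEliminationSigmaMaxModificationsCorridor3WLadderIsoTailsFreeRationalDictionary
import HarnessLib

/-!
# [OURS · L1 W4.2] D14 ROUTE H, object **H5 — THE FREE-RATIONAL STEP**, part 3/3: the forms with the base point named by an
# equation and along a Literature `BlowupTower`, incl. the frame socket along the tower (crux chain w42, line `w_ladder` v7, row `stub_Wtop3M_pointed`, kernel K1
# `IsoFreeRationalTailsImpossible`; `--supports stmt-ResolutionOfSingularities-19249`, helper)

OURS (cell `res-hironaka`, slot ★L-G4 W4.2, hand res-type-071 for res-L1-w42-plan-1 RULINGS v3.14-4 (BH); spec =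
res-L1-w42-lead-1's `D14-BRIDGE-CUT.md` sha16 `ca58498c1b3692f5`, ROUTE H row H5). NOT a statement of H. Hironaka's manuscript
[Hironaka2017] (under review in the cell, unused here) nor of [CossartJannsenSaito2020] / [CossartPiltant2008]; AI-written,
weaker than expert review. Sorry-free PROOF file: no definitions, no named facts. Continues parts 1/3 and 2/3.

## §7 Tower form
* `exists_origin_presentation_of_eq` — H5 (`exists_origin_presentation`, part 1/3) with the base point named by an equation
  `π x′ = x` (compatibilities through Mathlib's `stalkCongr`), cf. `exists_stalk_presentation_of_eq` (H4);
* `exists_origin_presentation_tower` — H5 at stage `n → n+1` of a Literature `BlowupTower` with `T.C n = {x_n}`,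
  `π_n(x_{n+1}) = x_n`, (RAT) = `IsRationalStep T pt n`; output in the input shape of `exists_stalk_presentation_tower` (H4), so a
  free-rational tail (`IsRationalStep ∧ ¬ IsSatelliteStep` from some `n₀` on, as in K1 `IsoFreeRationalTailsImpossible`) yields
  the chain of regular local rings `R_n → R_{n+1} = R_n[𝔪_n/t]_{(t, y′)}`, `y′_k = y_k/t − ã_k`, `h_n/1 = t^{m_n} h_{n+1}`
  consumed by ROUTE H's H6(c)(d) (res-L1-w42-lead-1); the next (FREE) is `¬ IsSatelliteStep T pt n` read through
  `not_isSatelliteStep_iff_forall_dvd` (part 2/3).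

## §9 The frame socket along a tower
* `map_comp_stalkMap_eq_iff_forall_dvd_of_eq`, `not_isSatelliteStep_iff_forall_dvd_of_eq` — the satellite dictionary with the
  data at `x_{n+1}` (`π_{n+1}(x_{n+2}) = x_{n+1}` as an equation);
* `exists_maximalIdeal_presentation_of_eq`, `exists_maximalIdeal_presentation_tower` — the frame socket
  (`exists_maximalIdeal_presentation`, part 2/3) with the base point named / along a `BlowupTower`: one step of
  res-L1-w42-lead-1's G1a-2 recursion over the embedded chart tower.

## References
* V. Cossart, O. Piltant, J. Algebra 320 (2008), proof of Lemma 4.3 (3). [CossartPiltant2008]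
* V. Cossart, U. Jannsen, S. Saito, LNM 2270 (2020), Def. 6.34 (6.25) (towers). [CossartJannsenSaito2020]
-/

noncomputable section

-- the mandated cell namespace `Summit.ResolutionOfSingularities.ResolutionOfSingularities.…` re-enters the summit name
set_option linter.dupNamespace false

open CategoryTheory AlgebraicGeometry TopologicalSpace IsLocalRing
open Literature.AlgebraicGeometry.Resolution
open Summit.ResolutionOfSingularities.ResolutionOfSingularities.Cruxes.SigmaMaxModifications.IdeasL1C5
  (IsRationalStep IsSatelliteStep)

namespace Summit.ResolutionOfSingularities.ResolutionOfSingularities.Cruxes.SigmaMaxModifications.IdeasL1C5.EmbeddedStep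

universe u

/-! ## §7. H5 along a point tower -/

section FreeRationalTower

variable {X X' : Scheme.{u}} {π : X' ⟶ X} {D : X.IdealSheafData}

set_option maxHeartbeats 1600000 in
-- long existential packaging over the affine blowup algebra of a stalk (as in `BlowupStalkBlowupAlgebra.lean`)
/-- **H5 with the base point named** (`π x′ = x` as an equation; compatibilities through Mathlib's `stalkCongr`), cf.
`exists_stalk_presentation_of_eq`. [cite: CossartPiltant2008, proof of Lemma 4.3 (3)] -/
theorem exists_origin_presentation_of_eq (hπ : IsBlowup π D) (x' : X') (x : X) (hx : π x' = x)
    (hD : stalkIdeal D x = maximalIdeal (X.presheaf.stalk x))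
    {R : Type u} [CommRing R] [IsRegularLocalRing R] {d : ℕ} (hd : (maximalIdeal R).spanFinrank = d)
    (c : Fin d → R) (hc : Ideal.span (Set.range c) = maximalIdeal R)
    (σ : R →+* X.presheaf.stalk x) (hσ : Function.Surjective σ) {h : R}
    (hker : RingHom.ker σ = Ideal.span {h}) {m : ℕ} (hm : h ∈ maximalIdeal R ^ m)
    (hm' : h ∉ maximalIdeal R ^ (m + 1)) (j₀ : Fin d)
    (hfree : ∀ k, (π.stalkMap x').hom ((X.presheaf.stalkCongr (.of_eq hx)).inv (σ (c j₀))) ∣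
      (π.stalkMap x').hom ((X.presheaf.stalkCongr (.of_eq hx)).inv (σ (c k))))
    (hrat : Function.Surjective (IsLocalRing.ResidueField.map (π.stalkMap x').hom)) :
    ∃ (a : {k : Fin d // k ≠ j₀} → R)
      (𝔔 : PrimeSpectrum (blowupAlgebra (Ideal.span (Set.range (shiftRsop c j₀ a))) (shiftRsop c j₀ a j₀)))
      (h' : blowupAlgebra (Ideal.span (Set.range (shiftRsop c j₀ a))) (shiftRsop c j₀ a j₀))
      (σ' : Localization.AtPrime 𝔔.asIdeal →+* X'.presheaf.stalk x'),
      algebraMap R _ h = algebraMap R _ (shiftRsop c j₀ a j₀) ^ m * h' ∧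
      Prime (algebraMap R (blowupAlgebra (Ideal.span (Set.range (shiftRsop c j₀ a))) (shiftRsop c j₀ a j₀))
        (shiftRsop c j₀ a j₀)) ∧
      ¬ algebraMap R (blowupAlgebra (Ideal.span (Set.range (shiftRsop c j₀ a))) (shiftRsop c j₀ a j₀))
        (shiftRsop c j₀ a j₀) ∣ h' ∧
      𝔔.asIdeal.comap (algebraMap R _) = maximalIdeal R ∧
      h' ∈ 𝔔.asIdeal ∧
      IsRegularLocalRing (Localization.AtPrime 𝔔.asIdeal) ∧
      Function.Surjective σ' ∧
      RingHom.ker σ' = Ideal.span {algebraMap _ (Localization.AtPrime 𝔔.asIdeal) h'} ∧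
      (∀ r : R, σ' (algebraMap _ (Localization.AtPrime 𝔔.asIdeal)
        (algebraMap R (blowupAlgebra (Ideal.span (Set.range (shiftRsop c j₀ a))) (shiftRsop c j₀ a j₀)) r)) =
          (π.stalkMap x').hom ((X.presheaf.stalkCongr (.of_eq hx)).inv (σ r))) ∧
      (∀ k : Fin d, σ' (algebraMap _ (Localization.AtPrime 𝔔.asIdeal) (blowupAlgebra.frac (shiftRsop c j₀ a) j₀ k)) *
        (π.stalkMap x').hom ((X.presheaf.stalkCongr (.of_eq hx)).inv (σ (shiftRsop c j₀ a j₀))) =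
          (π.stalkMap x').hom ((X.presheaf.stalkCongr (.of_eq hx)).inv (σ (shiftRsop c j₀ a k)))) ∧
      (π.stalkMap x').hom ((X.presheaf.stalkCongr (.of_eq hx)).inv (σ (shiftRsop c j₀ a j₀))) ∈
        nonZeroDivisors (X'.presheaf.stalk x') ∧
      stalkIdeal (D.comap π) x' =
        Ideal.span {(π.stalkMap x').hom ((X.presheaf.stalkCongr (.of_eq hx)).inv (σ (shiftRsop c j₀ a j₀)))} ∧
      (∀ k, k ≠ j₀ → blowupAlgebra.frac (shiftRsop c j₀ a) j₀ k ∈ 𝔔.asIdeal) ∧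
      (maximalIdeal (Localization.AtPrime 𝔔.asIdeal)).spanFinrank = d ∧
      Ideal.span (Set.range fun k : Fin d =>
        if k = j₀ then algebraMap _ (Localization.AtPrime 𝔔.asIdeal)
          (algebraMap R (blowupAlgebra (Ideal.span (Set.range (shiftRsop c j₀ a))) (shiftRsop c j₀ a j₀))
            (shiftRsop c j₀ a j₀))
        else algebraMap _ (Localization.AtPrime 𝔔.asIdeal) (blowupAlgebra.frac (shiftRsop c j₀ a) j₀ k)) =
        maximalIdeal (Localization.AtPrime 𝔔.asIdeal) ∧
      Function.Surjective ((IsLocalRing.residue (Localization.AtPrime 𝔔.asIdeal)).comp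
        ((algebraMap _ (Localization.AtPrime 𝔔.asIdeal)).comp
          (algebraMap R (blowupAlgebra (Ideal.span (Set.range (shiftRsop c j₀ a))) (shiftRsop c j₀ a j₀))))) := by
  subst hx
  have hid : ∀ a : X.presheaf.stalk (π x'),
      (X.presheaf.stalkCongr (.of_eq (rfl : π x' = π x'))).inv a = a := fun a => by
    rw [TopCat.Presheaf.stalkCongr_inv]
    exact stalkSpecializes_self_apply _ _ _ a
  have hfree' : ∀ k, (π.stalkMap x').hom (σ (c j₀)) ∣ (π.stalkMap x').hom (σ (c k)) := fun k => by
    have h := hfree k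
    rwa [hid, hid] at h
  obtain ⟨a, 𝔔, h', σ', h1, h2, h3, h4, h5, h6, h7, h8, h9, h10, h11, h12, h13, h14, h15, h16⟩ :=
    exists_origin_presentation hπ x' hD hd c hc σ hσ hker hm hm' j₀ hfree' hrat
  refine ⟨a, 𝔔, h', σ', h1, h2, h3, h4, h5, h6, h7, h8, fun r => ?_, fun k => ?_, ?_, ?_, h13, h14, h15, h16⟩
  · rw [hid]; exact h9 r
  · rw [hid, hid]; exact h10 k
  · rw [hid]; exact h11
  · rw [hid]; exact h12

open Literature.AlgebraicGeometry.CossartJannsenSaito2020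

set_option maxHeartbeats 1600000 in
-- long existential packaging over the affine blowup algebra of a stalk (as in `BlowupStalkBlowupAlgebra.lean`)
/-- **H5 along a point tower** (`T : BlowupTower` with `T.C n = {x_n}`, `π_n(x_{n+1}) = x_n`; hypersurface presentation
`σ : R ↠ 𝒪_{X_n,x_n}`; (FREE) at the index `j₀` of `t`, (RAT) = `IsRationalStep T pt n`): the free-rational step in the
input shape of `exists_stalk_presentation_tower`, so that it iterates along a free-rational tail — the next (FREE) is
`¬ IsSatelliteStep T pt n` read through `not_isSatelliteStep_iff_forall_dvd`. [cite: CossartPiltant2008, proof of Lemma 4.3 (3);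
CossartJannsenSaito2020, Def. 6.34 (6.25)] -/
theorem exists_origin_presentation_tower (T : BlowupTower.{u}) (pt : ∀ n, T.X n) (n : ℕ)
    (hC : T.C n = {pt n}) (hcl : IsClosed ({pt n} : Set (T.X n))) (hpt : (T.π n) (pt (n + 1)) = pt n)
    {R : Type u} [CommRing R] [IsRegularLocalRing R] {d : ℕ} (hd : (maximalIdeal R).spanFinrank = d)
    (c : Fin d → R) (hc : Ideal.span (Set.range c) = maximalIdeal R)
    (σ : R →+* (T.X n).presheaf.stalk (pt n)) (hσ : Function.Surjective σ) {h : R}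
    (hker : RingHom.ker σ = Ideal.span {h}) {m : ℕ} (hm : h ∈ maximalIdeal R ^ m)
    (hm' : h ∉ maximalIdeal R ^ (m + 1)) (j₀ : Fin d)
    (hfree : ∀ k, ((T.π n).stalkMap (pt (n + 1))).hom (((T.X n).presheaf.stalkCongr (.of_eq hpt)).inv (σ (c j₀))) ∣
      ((T.π n).stalkMap (pt (n + 1))).hom (((T.X n).presheaf.stalkCongr (.of_eq hpt)).inv (σ (c k))))
    (hrat : IsRationalStep T pt n) :
    ∃ (a : {k : Fin d // k ≠ j₀} → R)
      (𝔔 : PrimeSpectrum (blowupAlgebra (Ideal.span (Set.range (shiftRsop c j₀ a))) (shiftRsop c j₀ a j₀)))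
      (h' : blowupAlgebra (Ideal.span (Set.range (shiftRsop c j₀ a))) (shiftRsop c j₀ a j₀))
      (σ' : Localization.AtPrime 𝔔.asIdeal →+* (T.X (n + 1)).presheaf.stalk (pt (n + 1))),
      algebraMap R _ h = algebraMap R _ (shiftRsop c j₀ a j₀) ^ m * h' ∧
      Prime (algebraMap R (blowupAlgebra (Ideal.span (Set.range (shiftRsop c j₀ a))) (shiftRsop c j₀ a j₀))
        (shiftRsop c j₀ a j₀)) ∧
      ¬ algebraMap R (blowupAlgebra (Ideal.span (Set.range (shiftRsop c j₀ a))) (shiftRsop c j₀ a j₀))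
        (shiftRsop c j₀ a j₀) ∣ h' ∧
      𝔔.asIdeal.comap (algebraMap R _) = maximalIdeal R ∧
      h' ∈ 𝔔.asIdeal ∧
      IsRegularLocalRing (Localization.AtPrime 𝔔.asIdeal) ∧
      Function.Surjective σ' ∧
      RingHom.ker σ' = Ideal.span {algebraMap _ (Localization.AtPrime 𝔔.asIdeal) h'} ∧
      (∀ r : R, σ' (algebraMap _ (Localization.AtPrime 𝔔.asIdeal)
        (algebraMap R (blowupAlgebra (Ideal.span (Set.range (shiftRsop c j₀ a))) (shiftRsop c j₀ a j₀)) r)) =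
          ((T.π n).stalkMap (pt (n + 1))).hom (((T.X n).presheaf.stalkCongr (.of_eq hpt)).inv (σ r))) ∧
      (∀ k : Fin d, σ' (algebraMap _ (Localization.AtPrime 𝔔.asIdeal) (blowupAlgebra.frac (shiftRsop c j₀ a) j₀ k)) *
        ((T.π n).stalkMap (pt (n + 1))).hom
          (((T.X n).presheaf.stalkCongr (.of_eq hpt)).inv (σ (shiftRsop c j₀ a j₀))) =
          ((T.π n).stalkMap (pt (n + 1))).hom (((T.X n).presheaf.stalkCongr (.of_eq hpt)).inv (σ (shiftRsop c j₀ a k)))) ∧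
      ((T.π n).stalkMap (pt (n + 1))).hom (((T.X n).presheaf.stalkCongr (.of_eq hpt)).inv (σ (shiftRsop c j₀ a j₀))) ∈
        nonZeroDivisors ((T.X (n + 1)).presheaf.stalk (pt (n + 1))) ∧
      stalkIdeal ((T.centreIdeal n).comap (T.π n)) (pt (n + 1)) =
        Ideal.span {((T.π n).stalkMap (pt (n + 1))).hom
          (((T.X n).presheaf.stalkCongr (.of_eq hpt)).inv (σ (shiftRsop c j₀ a j₀)))} ∧
      (∀ k, k ≠ j₀ → blowupAlgebra.frac (shiftRsop c j₀ a) j₀ k ∈ 𝔔.asIdeal) ∧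
      (maximalIdeal (Localization.AtPrime 𝔔.asIdeal)).spanFinrank = d ∧
      Ideal.span (Set.range fun k : Fin d =>
        if k = j₀ then algebraMap _ (Localization.AtPrime 𝔔.asIdeal)
          (algebraMap R (blowupAlgebra (Ideal.span (Set.range (shiftRsop c j₀ a))) (shiftRsop c j₀ a j₀))
            (shiftRsop c j₀ a j₀))
        else algebraMap _ (Localization.AtPrime 𝔔.asIdeal) (blowupAlgebra.frac (shiftRsop c j₀ a) j₀ k)) =
        maximalIdeal (Localization.AtPrime 𝔔.asIdeal) ∧
      Function.Surjective ((IsLocalRing.residue (Localization.AtPrime 𝔔.asIdeal)).comp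
        ((algebraMap _ (Localization.AtPrime 𝔔.asIdeal)).comp
          (algebraMap R (blowupAlgebra (Ideal.span (Set.range (shiftRsop c j₀ a))) (shiftRsop c j₀ a j₀))))) :=
  exists_origin_presentation_of_eq (T.isBlowup n) (pt (n + 1)) (pt n) hpt
    (stalkIdeal_centreIdeal_eq_maximalIdeal T pt n hC hcl) hd c hc σ hσ hker hm hm' j₀ hfree hrat

end FreeRationalTower

/-! ## §9. The frame socket along a point tower -/

section FrameSocketTower

variable {X'' X' X : Scheme.{u}}

/-- **Satellite dictionary with the middle point named** (`π′ x″ = x′` as an equation; the exceptional parameter `g` and the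
generators `c′` given at `x′`, compatibilities through Mathlib's `stalkCongr`). [folklore] -/
theorem map_comp_stalkMap_eq_iff_forall_dvd_of_eq (π' : X'' ⟶ X') (π : X' ⟶ X) (x'' : X'') (x' : X')
    (hx : π' x'' = x') {g : X'.presheaf.stalk x'}
    (hE : (maximalIdeal (X.presheaf.stalk (π x'))).map (π.stalkMap x').hom = Ideal.span {g})
    {ι : Type*} {c' : ι → X'.presheaf.stalk x'}
    (hc' : Ideal.span (Set.range c') = maximalIdeal (X'.presheaf.stalk x')) :
    Ideal.map ((π' ≫ π).stalkMap x'').hom (maximalIdeal _) = Ideal.map (π'.stalkMap x'').hom (maximalIdeal _) ↔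
      ∀ k, (π'.stalkMap x'').hom ((X'.presheaf.stalkCongr (.of_eq hx)).inv g) ∣
        (π'.stalkMap x'').hom ((X'.presheaf.stalkCongr (.of_eq hx)).inv (c' k)) := by
  subst hx
  have hid : ∀ a : X'.presheaf.stalk (π' x''),
      (X'.presheaf.stalkCongr (.of_eq (rfl : π' x'' = π' x''))).inv a = a := fun a => by
    rw [TopCat.Presheaf.stalkCongr_inv]
    exact stalkSpecializes_self_apply _ _ _ a
  simp only [hid]
  exact map_comp_stalkMap_eq_iff_forall_dvd π' π x'' hE hc'

open Literature.AlgebraicGeometry.CossartJannsenSaito2020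

/-- **`¬ IsSatelliteStep` with the data at `x_{n+1}`** (`π_{n+1}(x_{n+2}) = x_{n+1}` as an equation): the form fed by the
stage-`n` output of `exists_maximalIdeal_presentation_tower` (`g = π_n♯σ_n(t)`, `c′` = the new r.s.p. pushed to `𝒪_{x_{n+1}}`).
[folklore] -/
theorem not_isSatelliteStep_iff_forall_dvd_of_eq (T : BlowupTower.{u}) (pt : ∀ n, T.X n) (n : ℕ)
    (hpt : (T.π (n + 1)) (pt (n + 2)) = pt (n + 1)) {g : (T.X (n + 1)).presheaf.stalk (pt (n + 1))}
    (hE : (maximalIdeal ((T.X n).presheaf.stalk ((T.π n) (pt (n + 1))))).map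
      ((T.π n).stalkMap (pt (n + 1))).hom = Ideal.span {g})
    {ι : Type*} {c' : ι → (T.X (n + 1)).presheaf.stalk (pt (n + 1))}
    (hc' : Ideal.span (Set.range c') = maximalIdeal _) :
    ¬ IsSatelliteStep T pt n ↔
      ∀ k, ((T.π (n + 1)).stalkMap (pt (n + 2))).hom (((T.X (n + 1)).presheaf.stalkCongr (.of_eq hpt)).inv g) ∣
        ((T.π (n + 1)).stalkMap (pt (n + 2))).hom (((T.X (n + 1)).presheaf.stalkCongr (.of_eq hpt)).inv (c' k)) := by
  rw [IsSatelliteStep, not_not]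
  exact map_comp_stalkMap_eq_iff_forall_dvd_of_eq (T.π (n + 1)) (T.π n) (pt (n + 2)) (pt (n + 1)) hpt hE hc'

variable {R : Type u} [CommRing R] {d : ℕ} (c : Fin d → R) (j : Fin d) {π : X' ⟶ X} {D : X.IdealSheafData}

set_option maxHeartbeats 1600000 in
-- long existential packaging over the affine blowup algebra of a stalk (as in `BlowupStalkBlowupAlgebra.lean`)
/-- **The frame socket with the base point named** (`π x′ = x` as an equation), cf. `exists_stalk_presentation_of_eq`.
[cite: CossartPiltant2008, proof of Lemma 4.3 (3)] -/
theorem exists_maximalIdeal_presentation_of_eq (hπ : IsBlowup π D) (x' : X') (x : X) (hx : π x' = x)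
    (hD : stalkIdeal D x = maximalIdeal (X.presheaf.stalk x))
    [IsRegularLocalRing R] (hd : (maximalIdeal R).spanFinrank = d)
    (hc : Ideal.span (Set.range c) = maximalIdeal R)
    (σ : R →+* X.presheaf.stalk x) (hσ : Function.Surjective σ) {h : R}
    (hker : RingHom.ker σ = Ideal.span {h}) {m : ℕ} (hm : h ∈ maximalIdeal R ^ m)
    (hm' : h ∉ maximalIdeal R ^ (m + 1))
    (hfree : ∀ k, (π.stalkMap x').hom ((X.presheaf.stalkCongr (.of_eq hx)).inv (σ (c j))) ∣
      (π.stalkMap x').hom ((X.presheaf.stalkCongr (.of_eq hx)).inv (σ (c k))))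
    (hrat : Function.Surjective (IsLocalRing.ResidueField.map (π.stalkMap x').hom)) :
    ∃ (a : {k : Fin d // k ≠ j} → R) (𝔑 : Ideal (blowupAlgebra (maximalIdeal R) (c j))) (_ : 𝔑.IsMaximal)
      (h' : blowupAlgebra (maximalIdeal R) (c j))
      (σ' : Localization.AtPrime 𝔑 →+* X'.presheaf.stalk x'),
      algebraMap R _ h = algebraMap R _ (c j) ^ m * h' ∧
      Prime (algebraMap R (blowupAlgebra (maximalIdeal R) (c j)) (c j)) ∧
      ¬ algebraMap R (blowupAlgebra (maximalIdeal R) (c j)) (c j) ∣ h' ∧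
      𝔑.comap (algebraMap R _) = maximalIdeal R ∧
      h' ∈ 𝔑 ∧
      algebraMap R (blowupAlgebra (maximalIdeal R) (c j)) (c j) ∈ 𝔑 ∧
      (∀ k (hk : k ≠ j), blowupAlgebra.gen (maximalIdeal R) (c j) (c k) (hc.le (Ideal.subset_span ⟨k, rfl⟩)) -
        algebraMap R _ (a ⟨k, hk⟩) ∈ 𝔑) ∧
      IsRegularLocalRing (Localization.AtPrime 𝔑) ∧
      (maximalIdeal (Localization.AtPrime 𝔑)).spanFinrank = d ∧
      Ideal.span (Set.range fun k : Fin d =>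
        if hk : k = j then algebraMap _ (Localization.AtPrime 𝔑) (algebraMap R (blowupAlgebra (maximalIdeal R) (c j)) (c j))
        else algebraMap _ (Localization.AtPrime 𝔑)
          (blowupAlgebra.gen (maximalIdeal R) (c j) (c k) (hc.le (Ideal.subset_span ⟨k, rfl⟩)) -
            algebraMap R _ (a ⟨k, hk⟩))) = maximalIdeal (Localization.AtPrime 𝔑) ∧
      Function.Surjective σ' ∧
      RingHom.ker σ' = Ideal.span {algebraMap _ (Localization.AtPrime 𝔑) h'} ∧
      (∀ r : R, σ' (algebraMap _ (Localization.AtPrime 𝔑) (algebraMap R (blowupAlgebra (maximalIdeal R) (c j)) r)) =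
        (π.stalkMap x').hom ((X.presheaf.stalkCongr (.of_eq hx)).inv (σ r))) ∧
      (π.stalkMap x').hom ((X.presheaf.stalkCongr (.of_eq hx)).inv (σ (c j))) ∈ nonZeroDivisors (X'.presheaf.stalk x') ∧
      stalkIdeal (D.comap π) x' = Ideal.span {(π.stalkMap x').hom ((X.presheaf.stalkCongr (.of_eq hx)).inv (σ (c j)))} ∧
      Function.Surjective ((IsLocalRing.residue (Localization.AtPrime 𝔑)).comp
        ((algebraMap _ (Localization.AtPrime 𝔑)).comp (algebraMap R (blowupAlgebra (maximalIdeal R) (c j))))) := by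
  subst hx
  have hid : ∀ a : X.presheaf.stalk (π x'),
      (X.presheaf.stalkCongr (.of_eq (rfl : π x' = π x'))).inv a = a := fun a => by
    rw [TopCat.Presheaf.stalkCongr_inv]
    exact stalkSpecializes_self_apply _ _ _ a
  simp only [hid] at hfree ⊢
  exact exists_maximalIdeal_presentation c j hπ x' hD hd hc σ hσ hker hm hm' hfree hrat

set_option maxHeartbeats 1600000 in
-- long existential packaging over the affine blowup algebra of a stalk (as in `BlowupStalkBlowupAlgebra.lean`)
/-- **The frame socket along a point tower** (`T : BlowupTower`, `T.C n = {x_n}`, `π_n(x_{n+1}) = x_n`; (RAT) =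
`IsRationalStep T pt n`; (FREE) at `t = c_j` from `not_isSatelliteStep_iff_forall_dvd_of_eq` of the previous stage): one step of
res-L1-w42-lead-1's G1a-2 recursion. [cite: CossartPiltant2008, proof of Lemma 4.3 (3); CossartJannsenSaito2020, Def. 6.34 (6.25)] -/
theorem exists_maximalIdeal_presentation_tower (T : BlowupTower.{u}) (pt : ∀ n, T.X n) (n : ℕ)
    (hC : T.C n = {pt n}) (hcl : IsClosed ({pt n} : Set (T.X n))) (hpt : (T.π n) (pt (n + 1)) = pt n)
    [IsRegularLocalRing R] (hd : (maximalIdeal R).spanFinrank = d)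
    (hc : Ideal.span (Set.range c) = maximalIdeal R)
    (σ : R →+* (T.X n).presheaf.stalk (pt n)) (hσ : Function.Surjective σ) {h : R}
    (hker : RingHom.ker σ = Ideal.span {h}) {m : ℕ} (hm : h ∈ maximalIdeal R ^ m)
    (hm' : h ∉ maximalIdeal R ^ (m + 1))
    (hfree : ∀ k, ((T.π n).stalkMap (pt (n + 1))).hom (((T.X n).presheaf.stalkCongr (.of_eq hpt)).inv (σ (c j))) ∣
      ((T.π n).stalkMap (pt (n + 1))).hom (((T.X n).presheaf.stalkCongr (.of_eq hpt)).inv (σ (c k))))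
    (hrat : IsRationalStep T pt n) :
    ∃ (a : {k : Fin d // k ≠ j} → R) (𝔑 : Ideal (blowupAlgebra (maximalIdeal R) (c j))) (_ : 𝔑.IsMaximal)
      (h' : blowupAlgebra (maximalIdeal R) (c j))
      (σ' : Localization.AtPrime 𝔑 →+* (T.X (n + 1)).presheaf.stalk (pt (n + 1))),
      algebraMap R _ h = algebraMap R _ (c j) ^ m * h' ∧
      Prime (algebraMap R (blowupAlgebra (maximalIdeal R) (c j)) (c j)) ∧
      ¬ algebraMap R (blowupAlgebra (maximalIdeal R) (c j)) (c j) ∣ h' ∧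
      𝔑.comap (algebraMap R _) = maximalIdeal R ∧
      h' ∈ 𝔑 ∧
      algebraMap R (blowupAlgebra (maximalIdeal R) (c j)) (c j) ∈ 𝔑 ∧
      (∀ k (hk : k ≠ j), blowupAlgebra.gen (maximalIdeal R) (c j) (c k) (hc.le (Ideal.subset_span ⟨k, rfl⟩)) -
        algebraMap R _ (a ⟨k, hk⟩) ∈ 𝔑) ∧
      IsRegularLocalRing (Localization.AtPrime 𝔑) ∧
      (maximalIdeal (Localization.AtPrime 𝔑)).spanFinrank = d ∧
      Ideal.span (Set.range fun k : Fin d =>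
        if hk : k = j then algebraMap _ (Localization.AtPrime 𝔑) (algebraMap R (blowupAlgebra (maximalIdeal R) (c j)) (c j))
        else algebraMap _ (Localization.AtPrime 𝔑)
          (blowupAlgebra.gen (maximalIdeal R) (c j) (c k) (hc.le (Ideal.subset_span ⟨k, rfl⟩)) -
            algebraMap R _ (a ⟨k, hk⟩))) = maximalIdeal (Localization.AtPrime 𝔑) ∧
      Function.Surjective σ' ∧
      RingHom.ker σ' = Ideal.span {algebraMap _ (Localization.AtPrime 𝔑) h'} ∧
      (∀ r : R, σ' (algebraMap _ (Localization.AtPrime 𝔑) (algebraMap R (blowupAlgebra (maximalIdeal R) (c j)) r)) =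
        ((T.π n).stalkMap (pt (n + 1))).hom (((T.X n).presheaf.stalkCongr (.of_eq hpt)).inv (σ r))) ∧
      ((T.π n).stalkMap (pt (n + 1))).hom (((T.X n).presheaf.stalkCongr (.of_eq hpt)).inv (σ (c j))) ∈
        nonZeroDivisors ((T.X (n + 1)).presheaf.stalk (pt (n + 1))) ∧
      stalkIdeal ((T.centreIdeal n).comap (T.π n)) (pt (n + 1)) =
        Ideal.span {((T.π n).stalkMap (pt (n + 1))).hom (((T.X n).presheaf.stalkCongr (.of_eq hpt)).inv (σ (c j)))} ∧
      Function.Surjective ((IsLocalRing.residue (Localization.AtPrime 𝔑)).comp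
        ((algebraMap _ (Localization.AtPrime 𝔑)).comp (algebraMap R (blowupAlgebra (maximalIdeal R) (c j))))) :=
  exists_maximalIdeal_presentation_of_eq c j (T.isBlowup n) (pt (n + 1)) (pt n) hpt
    (stalkIdeal_centreIdeal_eq_maximalIdeal T pt n hC hcl) hd hc σ hσ hker hm hm' hfree hrat

end FrameSocketTower

end Summit.ResolutionOfSingularities.ResolutionOfSingularities.Cruxes.SigmaMaxModifications.IdeasL1C5.EmbeddedStep

end
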